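import Mathlib
import HarnessLib
import Summits.QuantumFields.YangMills.Theorems.PencilRigidityCurvatureKernelBoundKernelOffDiagonalFrames
import Summits.QuantumFields.YangMills.Theorems.PencilRigidityCurvatureKernelBoundKernelOffDiagonalDilation

/-!
# `CurvatureKernelBound` — stub A3 support: local kernels of the dilated two-point functionals

Support file for crux `stmt-QuantumFields-11687` (`PencilRigidity.CurvatureKernelBound`), line
`sixteen-charts-analytic-kernel`, stub `KernelOffDiagonal` (A3).

`exists_local_kernels` (with the registered sub-goal `ChartNeighbourhoods` for its chart neighbourhoods): given the chart bounds of stub A1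
(hypothesis) and the tensor-regularity statement of stub A2 (hypothesis), a one-species family `𝔖` on
`ℝ⁴` with E2, translation invariance on `⁰𝒮`, invariance under proper signed permutations and
reflection positivity in the diagonal frames has, at every `ξ ≠ 0`, a radius `ρ`, a bound `B` and
growth data `q, C₀` such that for every scale `s > 0` the dilated two-point functional `F ↦ 𝔖₂(D_s F)`
is integration against a continuous kernel `k_s` on `B(ξ, ρ) × B(0, ρ)` with
`|k_s| ≤ (C₀ (s + s⁻¹)^q + 1) B`.  Assembly: good frames at `ξ` (sub-goal `GoodMirrorFrames`), A1 in
each frame, a common Schwartz order, the scaled chart bound (sub-goal `ScaledChartBound`), and A2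
applied to the normalised functional.
[folklore]
-/

noncomputable section

open scoped SchwartzMap LineDeriv InnerProductSpace
open Set MeasureTheory Metric
open Literature.MathematicalPhysics.AQFT Literature.MathematicalPhysics.QuantumLattice
open Literature.MathematicalPhysics.QuantumFieldTheory

namespace Summit.QuantumFields.YangMills.Theorems.CurvatureKernel

/-- **Sub-goal `ChartNeighbourhoods`** (helper for stub `KernelOffDiagonal`): the chart neighbourhoods
`U = {⟪x - ξ, n_i⟫ < d}` of `ξ` and `V = {⟪y, n_i⟫ > -d}` of `0` are open (finite intersections of open
half-spaces) and contain `ξ`, `0` for `d > 0`. [folklore] -/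
theorem ChartNeighbourhoods : ∀ (ξ : (EuclideanSpace ℝ (Fin 4))) (nrm : Fin 4 → (EuclideanSpace ℝ (Fin 4))) (d : ℝ), IsOpen {x : (EuclideanSpace ℝ (Fin 4)) | ∀ i : Fin 4, inner ℝ (x - ξ) (nrm i) < d} ∧ IsOpen {y : (EuclideanSpace ℝ (Fin 4)) | ∀ i : Fin 4, -d < inner ℝ y (nrm i)} ∧ (0 < d → ξ ∈ {x : (EuclideanSpace ℝ (Fin 4)) | ∀ i : Fin 4, inner ℝ (x - ξ) (nrm i) < d} ∧ (0 : (EuclideanSpace ℝ (Fin 4))) ∈ {y : (EuclideanSpace ℝ (Fin 4)) | ∀ i : Fin 4, -d < inner ℝ y (nrm i)}) := by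
  intro ξ nrm d
  refine ⟨?_, ?_, fun hd => ⟨fun i => by simpa using hd, fun i => by simpa using hd⟩⟩
  · rw [setOf_forall]
    exact isOpen_iInter_of_finite fun i =>
      isOpen_lt ((continuous_id.sub continuous_const).inner continuous_const) continuous_const
  · rw [setOf_forall]
    exact isOpen_iInter_of_finite fun i => isOpen_lt continuous_const (continuous_id.inner continuous_const)

/-- **Local kernels of the dilated two-point functionals.** See the module docstring. [folklore] -/
theorem exists_local_kernels
    (hA1 : ∀ (S₁ : SchwingerFamily (EuclideanSpace ℝ (Fin 4))) (R : (EuclideanSpace ℝ (Fin 4)) ≃ₗᵢ[ℝ] (EuclideanSpace ℝ (Fin 4))), (SchwingerFamily.toLabelled (fun n => (S₁ n).comp (linActMulti R))).IsReflectionPositive → (∀ (n : ℕ) (a : (EuclideanSpace ℝ (Fin 4))) (F : SchwartzMap (Fin n → (EuclideanSpace ℝ (Fin 4))) ℂ), IsOffDiagonal F → S₁ n (translateMulti a F) = S₁ n F) → ∃ M₀ : ℕ, ∀ N : ℕ, ∃ (C : ℝ) (p : ℕ), ∀ δ : ℝ, 0 < δ → δ ≤ 1 → ∀ (f g : SchwartzMap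 (EuclideanSpace ℝ (Fin 4)) ℂ), tsupport (f : (EuclideanSpace ℝ (Fin 4)) → ℂ) ⊆ {x : (EuclideanSpace ℝ (Fin 4)) | inner ℝ x (R (EuclideanSpace.single 0 1)) < 0} → tsupport (g : (EuclideanSpace ℝ (Fin 4)) → ℂ) ⊆ {x : (EuclideanSpace ℝ (Fin 4)) | δ < inner ℝ x (R (EuclideanSpace.single 0 1))} → ∀ F : SchwartzMap (Fin 2 → (EuclideanSpace ℝ (Fin 4))) ℂ, (IsTensorOf F ![((LineDeriv.lineDerivOp (R (EuclideanSpace.single 0 1)) : SchwartzMap (EuclideanSpace ℝ (Fin 4)) ℂ → SchwartzMap (EuclideanSpace ℝ (Fin 4)) ℂ)^[N] f), g] ∨ IsTensorOf F ![f, ((LineDeriv.lineDerivOp (R (EuclideanSpace.single 0 1)) : SchwartzMap (EuclideanSpace ℝ (Fin 4)) ℂ → SchwartzMap (EuclideanSpace ℝ (Fin 4)) ℂ)^[N] g)]) → ‖S₁ 2 F‖ ≤ C * (1 / δ) ^ p * schwartzNorm M₀ f * schwartzNorm M₀ g)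
    (hA2 : ∀ (v : Fin 4 → (EuclideanSpace ℝ (Fin 4))), LinearIndependent ℝ v → ∀ (U V : Set (EuclideanSpace ℝ (Fin 4))), IsOpen U → IsOpen V → ∀ (x₀ y₀ : (EuclideanSpace ℝ (Fin 4))), x₀ ∈ U → y₀ ∈ V → ∀ M₀ : ℕ, ∃ (N₁ : ℕ) (ρ B : ℝ), 0 < ρ ∧ ∀ Λ : SchwartzMap (Fin 2 → (EuclideanSpace ℝ (Fin 4))) ℂ →L[ℂ] ℂ, (∀ (j : Fin 4) (N : ℕ), N ≤ N₁ → ∀ (f g : SchwartzMap (EuclideanSpace ℝ (Fin 4)) ℂ), tsupport (f : (EuclideanSpace ℝ (Fin 4)) → ℂ) ⊆ U → tsupport (g : (EuclideanSpace ℝ (Fin 4)) → ℂ) ⊆ V → ∀ F : SchwartzMap (Fin 2 → (EuclideanSpace ℝ (Fin 4))) ℂ, (IsTensorOf F ![((LineDeriv.lineDerivOp (v j) : SchwartzMap (EuclideanSpace ℝ (Fin 4)) ℂ → SchwartzMap (EuclideanSpace ℝ (Fin 4)) ℂ)^[N] f), g] ∨ IsTensorOf F ![f, ((LineDeriv.lineDerivOp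 (v j) : SchwartzMap (EuclideanSpace ℝ (Fin 4)) ℂ → SchwartzMap (EuclideanSpace ℝ (Fin 4)) ℂ)^[N] g)]) → ‖Λ F‖ ≤ schwartzNorm M₀ f * schwartzNorm M₀ g) → ∃ K₂ : (Fin 2 → (EuclideanSpace ℝ (Fin 4))) → ℂ, ContinuousOn K₂ {x : Fin 2 → (EuclideanSpace ℝ (Fin 4)) | x 0 ∈ Metric.ball x₀ ρ ∧ x 1 ∈ Metric.ball y₀ ρ} ∧ (∀ x : Fin 2 → (EuclideanSpace ℝ (Fin 4)), x 0 ∈ Metric.ball x₀ ρ → x 1 ∈ Metric.ball y₀ ρ → ‖K₂ x‖ ≤ B) ∧ ∀ F : SchwartzMap (Fin 2 → (EuclideanSpace ℝ (Fin 4))) ℂ, tsupport (F : (Fin 2 → (EuclideanSpace ℝ (Fin 4))) → ℂ) ⊆ {x : Fin 2 → (EuclideanSpace ℝ (Fin 4)) | x 0 ∈ Metric.ball x₀ ρ ∧ x 1 ∈ Metric.ball y₀ ρ} → MeasureTheory.Integrable (fun x : Fin 2 → (EuclideanSpace ℝ (Fin 4)) => K₂ x * F x) ∧ Λ F = ∫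 x : Fin 2 → (EuclideanSpace ℝ (Fin 4)), K₂ x * F x)
    (S₁ : SchwingerFamily (EuclideanSpace ℝ (Fin 4))) (hE2 : S₁.toLabelled.IsReflectionPositive)
    (hT : ∀ (n : ℕ) (a : (EuclideanSpace ℝ (Fin 4))) (F : SchwartzMap (Fin n → (EuclideanSpace ℝ (Fin 4))) ℂ), IsOffDiagonal F → S₁ n (translateMulti a F) = S₁ n F)
    (hH : ∀ (R : (EuclideanSpace ℝ (Fin 4)) ≃ₗᵢ[ℝ] (EuclideanSpace ℝ (Fin 4))), LinearMap.det (R.toLinearEquiv : (EuclideanSpace ℝ (Fin 4)) →ₗ[ℝ] (EuclideanSpace ℝ (Fin 4))) = 1 → (∀ i : Fin 4, ∃ j : Fin 4, R (EuclideanSpace.single i 1) = EuclideanSpace.single j 1 ∨ R (EuclideanSpace.single i 1) = -EuclideanSpace.single j 1) → ∀ (n : ℕ) (F : SchwartzMap (Fin n → (EuclideanSpace ℝ (Fin 4))) ℂ), IsOffDiagonal F → S₁ n (linActMulti R F) = S₁ n F)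
    (hD : ∀ (R : (EuclideanSpace ℝ (Fin 4)) ≃ₗᵢ[ℝ] (EuclideanSpace ℝ (Fin 4))) (a b : ℝ), a ^ 2 = 1 / 2 → b ^ 2 = 1 / 2 → R (EuclideanSpace.single 0 1) = a • EuclideanSpace.single 0 1 + b • EuclideanSpace.single 1 1 → (SchwingerFamily.toLabelled (fun n => (S₁ n).comp (linActMulti R))).IsReflectionPositive)
    (ξ : (EuclideanSpace ℝ (Fin 4))) (hξ : ξ ≠ 0) :
    ∃ ρ : ℝ, 0 < ρ ∧ ∃ (B : ℝ) (q : ℕ) (C₀ : ℝ), 0 ≤ C₀ ∧ ∀ (s : ℝ) (hs : 0 < s),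
      ∃ k : (Fin 2 → (EuclideanSpace ℝ (Fin 4))) → ℂ, ContinuousOn k {x | x 0 ∈ ball ξ ρ ∧ x 1 ∈ ball 0 ρ} ∧
        (∀ x : Fin 2 → (EuclideanSpace ℝ (Fin 4)), x 0 ∈ ball ξ ρ → x 1 ∈ ball 0 ρ → ‖k x‖ ≤ (C₀ * (s + s⁻¹) ^ q + 1) * B) ∧
        ∀ F : 𝓢((Fin 2 → (EuclideanSpace ℝ (Fin 4))), ℂ), tsupport (F : (Fin 2 → (EuclideanSpace ℝ (Fin 4))) → ℂ) ⊆ {x | x 0 ∈ ball ξ ρ ∧ x 1 ∈ ball 0 ρ} →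
          Integrable (fun x => k x * F x) ∧ S₁ 2 (dilateTest s hs.ne' F) = ∫ x, k x * F x := by
  -- good frames at `ξ`
  obtain ⟨nrm, hli, hnrm⟩ := exists_good_frames S₁ hE2 hH hD ξ hξ
  have hn1 : ∀ j, ‖nrm j‖ = 1 := fun j => by
    obtain ⟨-, R, hR, -⟩ := hnrm j
    rw [← hR, LinearIsometryEquiv.norm_map]
    simp
  -- the chart bound of A1 along each normal
  have hA1j : ∀ j : Fin 4, ∃ M₀ : ℕ, ∀ N : ℕ, ∃ (C : ℝ) (p : ℕ), ∀ δ : ℝ, 0 < δ → δ ≤ 1 →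
      ∀ (f g : 𝓢((EuclideanSpace ℝ (Fin 4)), ℂ)), tsupport (f : (EuclideanSpace ℝ (Fin 4)) → ℂ) ⊆ {x | ⟪x, nrm j⟫_ℝ < 0} →
      tsupport (g : (EuclideanSpace ℝ (Fin 4)) → ℂ) ⊆ {x | δ < ⟪x, nrm j⟫_ℝ} → ∀ F : 𝓢((Fin 2 → (EuclideanSpace ℝ (Fin 4))), ℂ),
        (IsTensorOf F ![((∂_{nrm j} : 𝓢((EuclideanSpace ℝ (Fin 4)), ℂ) → 𝓢((EuclideanSpace ℝ (Fin 4)), ℂ))^[N] f), g] ∨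
          IsTensorOf F ![f, ((∂_{nrm j} : 𝓢((EuclideanSpace ℝ (Fin 4)), ℂ) → 𝓢((EuclideanSpace ℝ (Fin 4)), ℂ))^[N] g)]) →
        ‖S₁ 2 F‖ ≤ C * (1 / δ) ^ p * schwartzNorm M₀ f * schwartzNorm M₀ g := by
    intro j
    obtain ⟨-, R, hR, hE2R⟩ := hnrm j
    have h := hA1 S₁ R hE2R hT
    rw [hR] at h
    exact h
  choose M₀f hM using hA1j
  choose Cf pf hCp using hM
  set M₀ : ℕ := Finset.univ.sup M₀f with hM₀
  have hMle : ∀ j, M₀f j ≤ M₀ := fun j => Finset.le_sup (f := M₀f) (Finset.mem_univ j)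
  have hA : ∀ (j : Fin 4) (N : ℕ) (δ : ℝ), 0 < δ → δ ≤ 1 → ∀ (f g : 𝓢((EuclideanSpace ℝ (Fin 4)), ℂ)),
      tsupport (f : (EuclideanSpace ℝ (Fin 4)) → ℂ) ⊆ {x | ⟪x, nrm j⟫_ℝ < 0} →
      tsupport (g : (EuclideanSpace ℝ (Fin 4)) → ℂ) ⊆ {x | δ < ⟪x, nrm j⟫_ℝ} → ∀ F : 𝓢((Fin 2 → (EuclideanSpace ℝ (Fin 4))), ℂ),
        (IsTensorOf F ![((∂_{nrm j} : 𝓢((EuclideanSpace ℝ (Fin 4)), ℂ) → 𝓢((EuclideanSpace ℝ (Fin 4)), ℂ))^[N] f), g] ∨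
          IsTensorOf F ![f, ((∂_{nrm j} : 𝓢((EuclideanSpace ℝ (Fin 4)), ℂ) → 𝓢((EuclideanSpace ℝ (Fin 4)), ℂ))^[N] g)]) →
        ‖S₁ 2 F‖ ≤ |Cf j N| * (1 / δ) ^ (pf j N) * schwartzNorm M₀ f * schwartzNorm M₀ g := by
    intro j N δ hδ hδ1 f g hf hg F hF
    refine (hCp j N δ hδ hδ1 f g hf hg F hF).trans ?_
    have hsf := schwartzNorm_nonneg (M₀f j) f
    have hsg := schwartzNorm_nonneg (M₀f j) g
    have hsf' := schwartzNorm_nonneg M₀ f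
    have h0 : 0 ≤ (1 / δ) ^ (pf j N) * schwartzNorm (M₀f j) f * schwartzNorm (M₀f j) g := by positivity
    calc Cf j N * (1 / δ) ^ (pf j N) * schwartzNorm (M₀f j) f * schwartzNorm (M₀f j) g
        = Cf j N * ((1 / δ) ^ (pf j N) * schwartzNorm (M₀f j) f * schwartzNorm (M₀f j) g) := by ring
      _ ≤ |Cf j N| * ((1 / δ) ^ (pf j N) * schwartzNorm (M₀f j) f * schwartzNorm (M₀f j) g) :=
          mul_le_mul_of_nonneg_right (le_abs_self _) h0
      _ ≤ |Cf j N| * ((1 / δ) ^ (pf j N) * schwartzNorm M₀ f * schwartzNorm M₀ g) := by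
          gcongr
          · exact schwartzNorm_mono (hMle j) f
          · exact schwartzNorm_mono (hMle j) g
      _ = _ := by ring
  -- the gap `d`
  obtain ⟨j₀, -, hj₀⟩ := Finset.exists_max_image Finset.univ (fun j => ⟪ξ, nrm j⟫_ℝ) Finset.univ_nonempty
  set d : ℝ := -⟪ξ, nrm j₀⟫_ℝ / 3 with hddef
  have hd : 0 < d := by
    have := (hnrm j₀).1
    rw [hddef]
    linarith
  have hdξ : ∀ j, ⟪ξ, nrm j⟫_ℝ ≤ -(3 * d) := fun j => by
    have := hj₀ j (Finset.mem_univ j)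
    rw [hddef]
    linarith
  -- the open sets `U ∋ ξ`, `V ∋ 0`
  set U : Set (EuclideanSpace ℝ (Fin 4)) := {x | ∀ i, ⟪x - ξ, nrm i⟫_ℝ < d} with hUdef
  set V : Set (EuclideanSpace ℝ (Fin 4)) := {y | ∀ i, -d < ⟪y, nrm i⟫_ℝ} with hVdef
  obtain ⟨hU, hV, hUV⟩ := ChartNeighbourhoods ξ nrm d
  obtain ⟨hξU, h0V⟩ := hUV hd
  -- A2 data, the scaled chart bound
  obtain ⟨N₁, ρ, B, hρ, hA2'⟩ := hA2 nrm hli U V hU hV ξ 0 hξU h0V M₀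
  obtain ⟨q, C₀, hC₀, hbound⟩ := scaled_chart_bound S₁ hT nrm hn1 M₀ (fun j N => |Cf j N|) pf hA ξ hd hdξ N₁
  refine ⟨ρ, hρ, B, q, C₀, hC₀, fun s hs => ?_⟩
  set c : ℝ := C₀ * (s + s⁻¹) ^ q + 1 with hcdef
  have hss : 0 < s + s⁻¹ := by positivity
  have hc : 0 < c := by positivity
  have hcC : (c : ℂ) ≠ 0 := Complex.ofReal_ne_zero.2 hc.ne'
  set Λ : 𝓢((Fin 2 → (EuclideanSpace ℝ (Fin 4))), ℂ) →L[ℂ] ℂ := ((c : ℂ)⁻¹) • (S₁ 2).comp (dilateTest s hs.ne') with hΛdef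
  have hΛapply : ∀ F, Λ F = (c : ℂ)⁻¹ * S₁ 2 (dilateTest s hs.ne' F) := fun F => rfl
  have hΛ : ∀ (j : Fin 4) (N : ℕ), N ≤ N₁ → ∀ (f g : 𝓢((EuclideanSpace ℝ (Fin 4)), ℂ)), tsupport (f : (EuclideanSpace ℝ (Fin 4)) → ℂ) ⊆ U →
      tsupport (g : (EuclideanSpace ℝ (Fin 4)) → ℂ) ⊆ V → ∀ F : 𝓢((Fin 2 → (EuclideanSpace ℝ (Fin 4))), ℂ),
        (IsTensorOf F ![((∂_{nrm j} : 𝓢((EuclideanSpace ℝ (Fin 4)), ℂ) → 𝓢((EuclideanSpace ℝ (Fin 4)), ℂ))^[N] f), g] ∨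
          IsTensorOf F ![f, ((∂_{nrm j} : 𝓢((EuclideanSpace ℝ (Fin 4)), ℂ) → 𝓢((EuclideanSpace ℝ (Fin 4)), ℂ))^[N] g)]) →
        ‖Λ F‖ ≤ schwartzNorm M₀ f * schwartzNorm M₀ g := by
    intro j N hN f g hf hg F hF
    rw [hΛapply, norm_mul, norm_inv, Complex.norm_real, Real.norm_of_nonneg hc.le]
    have h := hbound s hs j N hN f g hf hg F hF
    have hsfg : 0 ≤ schwartzNorm M₀ f * schwartzNorm M₀ g :=
      mul_nonneg (schwartzNorm_nonneg _ _) (schwartzNorm_nonneg _ _)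
    have hle : c⁻¹ * (C₀ * (s + s⁻¹) ^ q) ≤ 1 := by
      rw [inv_mul_le_iff₀ hc, mul_one, hcdef]
      linarith
    calc c⁻¹ * ‖S₁ 2 (dilateTest s hs.ne' F)‖
        ≤ c⁻¹ * (C₀ * (s + s⁻¹) ^ q * schwartzNorm M₀ f * schwartzNorm M₀ g) :=
          mul_le_mul_of_nonneg_left h (inv_nonneg.2 hc.le)
      _ = (c⁻¹ * (C₀ * (s + s⁻¹) ^ q)) * (schwartzNorm M₀ f * schwartzNorm M₀ g) := by ring
      _ ≤ 1 * (schwartzNorm M₀ f * schwartzNorm M₀ g) := mul_le_mul_of_nonneg_right hle hsfg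
      _ = schwartzNorm M₀ f * schwartzNorm M₀ g := one_mul _
  obtain ⟨K₂, hcont, hbd, hrep⟩ := hA2' Λ hΛ
  refine ⟨fun x => (c : ℂ) * K₂ x, continuousOn_const.mul hcont, fun x hx0 hx1 => ?_, fun F hF => ?_⟩
  · rw [norm_mul, Complex.norm_real, Real.norm_of_nonneg hc.le]
    exact mul_le_mul_of_nonneg_left (hbd x hx0 hx1) hc.le
  · obtain ⟨hi, hΛF⟩ := hrep F hF
    refine ⟨by simpa only [mul_assoc] using hi.const_mul (c : ℂ), ?_⟩
    rw [hΛapply] at hΛF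
    have h1 : S₁ 2 (dilateTest s hs.ne' F) = (c : ℂ) * ((c : ℂ)⁻¹ * S₁ 2 (dilateTest s hs.ne' F)) := by
      rw [← mul_assoc, mul_inv_cancel₀ hcC, one_mul]
    rw [h1, hΛF, ← integral_const_mul]
    simp only [mul_assoc]

end Summit.QuantumFields.YangMills.Theorems.CurvatureKernel

end
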